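import Literature.Geometry.Lorentzian.ConformalScalarFlatSign
import Literature.Geometry.Lorentzian.PositiveMassConformalProofs
import HarnessLib

/-!
# Step 1 of Schoen–Yau's Theorem 1 with the conformal transformation law discharged

The reduction of Step 1 of the proof of Schoen–Yau's Thm. 1 (`PositiveMassConformalProofs.lean`,
`exists_conformal_scalarPos_of_massNeg_of_ingredients`) takes the conformal transformation law
`R(φ⁴ h) = φ⁻⁵ (R(h) φ − 8 Δ_h φ)` (Schoen–Yau, Comm. Math. Phys. 65 (1979), p. 49: "the
well-known formula") as an explicit hypothesis `hconf`. That law is now a theorem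
(`conformal_scalarCurvature_law`, `ConformalChange.lean`; for conformal data,
`InitialDataSet.scalarCurvature_conformal` of `ConformalScalarFlatSign.lean`, which already feeds
it into the reductions of Cor. 3.1). This file feeds it into the Step-1 side:

* `conformal_scalarCurvature_law_data` — the law in the shape of the hypothesis `hR` of
  `ConformalScalarFlat.lean` (a repackaging of `InitialDataSet.scalarCurvature_conformal`);
* `exists_conformal_scalarPos_of_massNeg_of_superharmonicFactor` — **Step 1 of Thm. 1** (the
  named fact `exists_conformal_scalarPos_of_massNeg`) from its one remaining printed ingredient,
  the superharmonic conformal factor (2.1)–(2.3);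
* `schoenYau_mass_nonneg_of_superharmonicFactor` — hence Thm. 1 (`schoenYau_mass_nonneg`) from
  (2.1)–(2.3) and Steps 2–3 of its proof (pp. 49–63; like the other research-level leaves of this
  file a written-out hypothesis, `h₂₃` — a slice of the printed proof of Thm. 1, not a named
  fact of the tree);
* `scalarFlat_of_massZero_of_printed_steps` — **the named fact `scalarFlat_of_massZero`**
  (Schoen–Yau 1979, p. 72: "Theorem 1 and Corollary 3.1 imply that an asymptotically flat metric
  satisfying the hypotheses `M = 0`, `R ≥ 0` must have `R = 0` on `N`") from the three
  research-level leaves that remain of its printed proof: the superharmonic factor (2.1)–(2.3),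
  Steps 2–3 of the proof of Thm. 1 (the minimal-surface argument), and the elliptic core of
  Lemmas 3.2–3.3 with the formula (3.16) (`scalarFlat_of_massZero_of_ellipticCore`).

Everything here is proved; no named facts are introduced.

## References

* R. Schoen, S.-T. Yau, *On the proof of the positive mass conjecture in general relativity*,
  Comm. Math. Phys. 65 (1979) 45–76: Thm. 1 (p. 48), §2 Step 1 (pp. 48–49, (2.1)–(2.3)),
  Lemmas 3.2–3.3 ((3.16)–(3.23)), Cor. 3.1 and the paragraph following it (p. 72).
-/

noncomputable section

open Bundle Set Manifold TopologicalSpace Filter Asymptotics Bornology Module MeasureTheory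
open scoped ContDiff Topology Manifold

namespace Literature.Geometry.Lorentzian

/-! ### The law for conformal data -/

/-- The conformal transformation law in the shape of the hypothesis `hR` of
`exists_conformal_negativeMass_of_massZero_of_conformalFactor` (`ConformalScalarFlat.lean`) and
`exists_conformal_negativeMass_of_massZero_of_conformalFactor_integral`
(`ConformalScalarFlatSign.lean`). Schoen–Yau 1979, p. 49. [cite: SchoenYauPMT1979, §2 Step 1 (p. 49)] -/
theorem conformal_scalarCurvature_law_data :
    ∀ (X : Type) [TopologicalSpace X] [ChartedSpace E3 X] [IsManifold (𝓡 3) ∞ X]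
      (D : InitialDataSet (𝓡 3) X) [D.metric.HasLeviCivita] (φ : X → ℝ)
      (hφ : ContMDiff (𝓡 3) 𝓘(ℝ) ∞ φ) (hpos : ∀ x, 0 < φ x)
      [(D.conformal φ hφ hpos).metric.HasLeviCivita] (x : X),
      (D.conformal φ hφ hpos).metric.scalarCurvature x =
        (φ x)⁻¹ ^ 5 * (D.metric.scalarCurvature x * φ x - 8 * D.metric.dalembertian φ x) :=
  fun X _ _ _ D _ φ hφ hpos _ x ↦ InitialDataSet.scalarCurvature_conformal X D φ hφ hpos x

/-! ### Step 1 of Theorem 1 from the superharmonic factor alone -/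

/-- **Schoen–Yau's Step 1 from the superharmonic conformal factor.** The named fact
`exists_conformal_scalarPos_of_massNeg` (Schoen–Yau 1979, §2 Step 1, pp. 48–49) follows from the
one printed ingredient that remains a hypothesis — (2.1)–(2.3): on an end with the expansion
(1.1) and `M < 0` there are a smooth positive `φ` on `X` and a radius `ρ ≥ e.R` with `Δ_h φ ≤ 0`
on `X`, `Δ_h φ < 0` on `e.far ρ` and `φ = 1 − M/4r` beyond `ρ` in the chart — by
`exists_conformal_scalarPos_of_massNeg_of_ingredients` (`PositiveMassConformalProofs.lean`), whose
other hypothesis, the transformation law `R(φ⁴ g) = φ⁻⁵ (R(g) φ − 8 Δ_g φ)`, is the theorem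
`conformal_scalarCurvature_law`. [cite: SchoenYauPMT1979, §2 Step 1 (pp. 48–49)] -/
theorem exists_conformal_scalarPos_of_massNeg_of_superharmonicFactor
    (hfac : ∀ (X : Type) [TopologicalSpace X] [ChartedSpace E3 X] [IsManifold (𝓡 3) ∞ X]
      [T2Space X] [SecondCountableTopology X] [ConnectedSpace X]
      (D : InitialDataSet (𝓡 3) X) [D.metric.HasLeviCivita] (e : AFEnd X) (M : ℝ),
      IsAsymptoticallySchwarzschild e D M 2 → M < 0 →
      ∃ (φ : X → ℝ) (ρ : ℝ), e.R ≤ ρ ∧ ContMDiff (𝓡 3) 𝓘(ℝ) ∞ φ ∧ (∀ x : X, 0 < φ x) ∧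
        (∀ x : X, D.metric.dalembertian φ x ≤ 0) ∧
        (∀ x ∈ e.far ρ, D.metric.dalembertian φ x < 0) ∧
        ∀ y : exteriorRegion e.R, ρ < ‖(y : E3)‖ →
          φ (e.dataChart y) = 1 - M / (4 * ‖(y : E3)‖)) :
    exists_conformal_scalarPos_of_massNeg :=
  exists_conformal_scalarPos_of_massNeg_of_ingredients conformal_scalarCurvature_law hfac

/-- **Theorem 1 from the superharmonic factor and Steps 2–3.** The positive mass theorem in
Schoen–Yau's form (`schoenYau_mass_nonneg`, Thm. 1, p. 48) follows from the superharmonic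
conformal factor (2.1)–(2.3) of Step 1 and from Steps 2–3 of its proof (pp. 49–63, the
minimal-surface argument, written out as the hypothesis `h₂₃`: with `R ≥ 0` on `N`, `R > 0`
outside a compact subset of the one end and the expansion (1.1), the mass is not negative), by
`schoenYau_mass_nonneg_of_steps`. [cite: SchoenYauPMT1979, Thm. 1 (p. 48) and §2] -/
theorem schoenYau_mass_nonneg_of_superharmonicFactor
    (hfac : ∀ (X : Type) [TopologicalSpace X] [ChartedSpace E3 X] [IsManifold (𝓡 3) ∞ X]
      [T2Space X] [SecondCountableTopology X] [ConnectedSpace X]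
      (D : InitialDataSet (𝓡 3) X) [D.metric.HasLeviCivita] (e : AFEnd X) (M : ℝ),
      IsAsymptoticallySchwarzschild e D M 2 → M < 0 →
      ∃ (φ : X → ℝ) (ρ : ℝ), e.R ≤ ρ ∧ ContMDiff (𝓡 3) 𝓘(ℝ) ∞ φ ∧ (∀ x : X, 0 < φ x) ∧
        (∀ x : X, D.metric.dalembertian φ x ≤ 0) ∧
        (∀ x ∈ e.far ρ, D.metric.dalembertian φ x < 0) ∧
        ∀ y : exteriorRegion e.R, ρ < ‖(y : E3)‖ →
          φ (e.dataChart y) = 1 - M / (4 * ‖(y : E3)‖))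
    (h₂₃ : ∀ (X : Type) [TopologicalSpace X] [ChartedSpace E3 X] [IsManifold (𝓡 3) ∞ X]
      [T2Space X] [SecondCountableTopology X] [ConnectedSpace X]
      (D : InitialDataSet (𝓡 3) X) [D.metric.HasLeviCivita] (e : AFEnd X) (M : ℝ),
      Literature.Topology.FourManifolds.IsOrientable (𝓡 3) X →
      IsAsymptoticallySchwarzschild e D M 2 → e.IsSoleEnd →
      (∀ x : X, 0 ≤ D.metric.scalarCurvature x) →
      (∃ ρ : ℝ, ∀ x ∈ e.far ρ, 0 < D.metric.scalarCurvature x) → 0 ≤ M) :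
    schoenYau_mass_nonneg :=
  schoenYau_mass_nonneg_of_steps (exists_conformal_scalarPos_of_massNeg_of_superharmonicFactor hfac)
    h₂₃

/-! ### `scalarFlat_of_massZero` from the remaining printed steps -/

/-- **`scalarFlat_of_massZero` from the three research-level leaves of its printed proof.**
Schoen–Yau 1979, p. 72: "Theorem 1 and Corollary 3.1 imply that an asymptotically flat metric
satisfying the hypotheses `M = 0`, `R ≥ 0` must have `R = 0` on `N`". With the conformal
transformation law proved, what remains of the printed argument is: for Thm. 1, the
superharmonic conformal factor (2.1)–(2.3) of Step 1 (`hfac`) and the minimal-surface argument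
of Steps 2–3, pp. 49–63 (`h₂₃`, written out as in `schoenYau_mass_nonneg_of_superharmonicFactor`);
for Cor. 3.1, the elliptic core of Lemmas 3.2–3.3 with the formula (3.16) (`hcore`).
[cite: SchoenYauPMT1979, Thm. 1 and Cor. 3.1 (p. 72)] -/
theorem scalarFlat_of_massZero_of_printed_steps
    (hfac : ∀ (X : Type) [TopologicalSpace X] [ChartedSpace E3 X] [IsManifold (𝓡 3) ∞ X]
      [T2Space X] [SecondCountableTopology X] [ConnectedSpace X]
      (D : InitialDataSet (𝓡 3) X) [D.metric.HasLeviCivita] (e : AFEnd X) (M : ℝ),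
      IsAsymptoticallySchwarzschild e D M 2 → M < 0 →
      ∃ (φ : X → ℝ) (ρ : ℝ), e.R ≤ ρ ∧ ContMDiff (𝓡 3) 𝓘(ℝ) ∞ φ ∧ (∀ x : X, 0 < φ x) ∧
        (∀ x : X, D.metric.dalembertian φ x ≤ 0) ∧
        (∀ x ∈ e.far ρ, D.metric.dalembertian φ x < 0) ∧
        ∀ y : exteriorRegion e.R, ρ < ‖(y : E3)‖ →
          φ (e.dataChart y) = 1 - M / (4 * ‖(y : E3)‖))
    (h₂₃ : ∀ (X : Type) [TopologicalSpace X] [ChartedSpace E3 X] [IsManifold (𝓡 3) ∞ X]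
      [T2Space X] [SecondCountableTopology X] [ConnectedSpace X]
      (D : InitialDataSet (𝓡 3) X) [D.metric.HasLeviCivita] (e : AFEnd X) (M : ℝ),
      Literature.Topology.FourManifolds.IsOrientable (𝓡 3) X →
      IsAsymptoticallySchwarzschild e D M 2 → e.IsSoleEnd →
      (∀ x : X, 0 ≤ D.metric.scalarCurvature x) →
      (∃ ρ : ℝ, ∀ x ∈ e.far ρ, 0 < D.metric.scalarCurvature x) → 0 ≤ M)
    (hcore : ∀ (X : Type) [TopologicalSpace X] [ChartedSpace E3 X] [IsManifold (𝓡 3) ∞ X]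
      [T2Space X] [SecondCountableTopology X] [LocallyCompactSpace X] [ConnectedSpace X]
      [MeasurableSpace X] [BorelSpace X]
      (D : InitialDataSet (𝓡 3) X) [D.metric.HasLeviCivita] (e : AFEnd X),
      Literature.Topology.FourManifolds.IsOrientable (𝓡 3) X →
      e.IsStronglyAsymptoticallyFlatWith D 0 2 0 5 0 → e.IsSoleEnd →
      (∀ x : X, 0 ≤ D.metric.scalarCurvature x) →
      ∃ (φ : X → ℝ) (A : ℝ), ContMDiff (𝓡 3) 𝓘(ℝ) ∞ φ ∧ (∀ x, 0 < φ x) ∧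
        (∀ x, D.metric.dalembertian φ x = D.metric.scalarCurvature x * φ x / 8) ∧
        Integrable (fun x ↦ D.metric.scalarCurvature x * φ x) (riemannianMeasure D.h) ∧
        A = -(32 * Real.pi)⁻¹ *
          ∫ x, D.metric.scalarCurvature x * φ x ∂(riemannianMeasure D.h) ∧
        ∀ m : ℕ, m ≤ 2 →
          (fun x ↦ ‖iteratedFDeriv ℝ m (fun y ↦ endValue e φ y - (1 + A / ‖y‖)) x‖)
            =O[cobounded E3] fun x ↦ ‖x‖ ^ (-2 - m : ℝ)) :
    scalarFlat_of_massZero :=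
  scalarFlat_of_massZero_of_ellipticCore (schoenYau_mass_nonneg_of_superharmonicFactor hfac h₂₃)
    hcore

end Literature.Geometry.Lorentzian

end
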